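import Mathlib.LinearAlgebra.Matrix.GeneralLinearGroup.Card
import Literature.NumberTheory.EllipticCurves.SerreOpenImageDeterminantProofs
import Literature.NumberTheory.EllipticCurves.GaloisActionProofs
import Literature.NumberTheory.GaloisRepresentations.ArtinRestriction
import HarnessLib

/-!
# Degrees of division fields: `#ρ̄_{E,p}(Γ_K) ∣ |GL₂(𝔽_p)| = p(p−1)²(p+1)` and `[L:K] ∣ p(p−1)²(p+1)`
# for every `L ⊆ K(E[p])` ([IUTchIV] Thm. 1.10, proof, Step (i) (E3) and Step (ii))

`Proofs` file (theorems only: no definition, no named fact), topic `NumberTheory/EllipticCurves`.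

S. Mochizuki, *Inter-universal Teichmüller theory IV*, proof of Thm. 1.10, p. 24: "(E3) For `p` a prime
number, the cardinality `|GL₂(𝔽_p)|` of `GL₂(𝔽_p)` is given by `|GL₂(𝔽_p)| = p(p+1)(p−1)²`"; used in
Step (ii) through "a natural outer inclusion `Gal(K/F) ↪ GL₂(𝔽_l)`" (and `Gal(F/F_tpd) ↪ GL₂(𝔽₃) ×
GL₂(𝔽₅) × ℤ/2ℤ`) to bound `v_p([K:F])` in Prop. 1.3 (ii).  Here, for an elliptic curve `E = W` over a
number field `K`, a prime `p`, and `Γ_K = Gal(K̄/K)` acting on `E[p] = geomTorsion W p` through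
`ρ̄_{E,p} = W.galoisRepTorsion p`:

* `WeierstrassCurve.card_GL_two_zmod` — `Nat.card (GL (Fin 2) (ZMod p)) = p(p−1)²(p+1)` ((E3); Mathlib
  `Matrix.card_GL_field`);
* `WeierstrassCurve.natCard_range_galoisRepTorsion_dvd` — **`#ρ̄_{E,p}(Γ_K) ∣ p(p−1)²(p+1)`**
  (`E[p] ≅ 𝔽_p²`, tree `card_torsionPoints_eq_sq_holds`, framed by the tree's
  `exists_addEquiv_mulEquiv_addAut_GL2 : Aut(E[p]) ≅ GL₂(𝔽_p)`);
* `WeierstrassCurve.finrank_dvd_of_ker_galoisRepTorsion_le_fixingSubgroup` — **for every finite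
  subextension `L ⊆ K̄` of `K` fixed by `ker ρ̄_{E,p}` (i.e. `L ⊆ K(E[p])`): `[L:K] ∣ p(p−1)²(p+1)`**
  (`[L:K] = [Γ_K : Gal(K̄/L)] ∣ [Γ_K : ker ρ̄] = #ρ̄(Γ_K)`), and the `p`-division field itself,
  `WeierstrassCurve.finrank_fixedField_ker_galoisRepTorsion_dvd` (`L = K̄^{ker ρ̄}`);
* `WeierstrassCurve.finrank_dvd_of_ker_inf_ker_le_fixingSubgroup` — two levels `p, q`: for
  `L ⊆ K(E[p], E[q])` (`ker ρ̄_p ⊓ ker ρ̄_q ≤ Gal(K̄/L)`), `[L:K] ∣ p(p−1)²(p+1) · q(q−1)²(q+1)` (the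
  shape of "`Gal(F/F_tpd) ↪ GL₂(𝔽₃) × GL₂(𝔽₅) × …`", `(p, q) = (3, 5)`; the factor `ℤ/2ℤ` for `√−1` is
  left to the consumer).

Classical; nothing here bears on [IUTchIII] Cor. 3.12 (the IUT locator records where (E3) is consumed).

## References

* [Serre1972] J.-P. Serre, Invent. Math. 15 (1972), §4.1 (`φ_l : G → Aut(E_l) ≅ GL₂(𝔽_l)`).
* [SilvermanAEC2009] J. H. Silverman, *The Arithmetic of Elliptic Curves*, 2nd ed., III.§7.
* [Mochizuki2012] S. Mochizuki, *Inter-universal Teichmüller theory IV*, proof of Thm. 1.10, Step (i)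
  (E3) and Step (ii), p. 24 (consumer locator).
-/

noncomputable section

open scoped Classical

open Field

universe u

namespace WeierstrassCurve

open Literature.NumberTheory.EllipticCurves Literature.NumberTheory.GaloisRepresentations

/-- **(E3)** `|GL₂(𝔽_p)| = p(p+1)(p−1)²` ([IUTchIV] proof of Thm. 1.10, Step (i), p. 24; Mathlib's
`Matrix.card_GL_field`: `∏_{i<2} (p² − pⁱ) = (p² − 1)(p² − p)`).
[cite: Mochizuki2012, IUTchIV Thm 1.10 proof Step (i) (E3) p.24] -/
theorem card_GL_two_zmod (p : ℕ) [Fact p.Prime] :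
    Nat.card (GL (Fin 2) (ZMod p)) = p * (p - 1) ^ 2 * (p + 1) := by
  rw [Matrix.card_GL_field, ZMod.card, Fin.prod_univ_two]
  simp only [Fin.val_zero, Fin.val_one, pow_zero, pow_one]
  have h1 : p ^ 2 - 1 = (p + 1) * (p - 1) := by
    have := Nat.sq_sub_sq p 1
    simpa only [one_pow] using this
  have h2 : p ^ 2 - p = p * (p - 1) := by
    rw [pow_two, Nat.mul_sub_one]
  rw [h1, h2]
  ring

variable {K : Type u} [Field K] [NumberField K] (W : WeierstrassCurve K) [W.IsElliptic]
  (p : ℕ) [hp : Fact p.Prime]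

/-- **`#ρ̄_{E,p}(Γ_K) ∣ |GL₂(𝔽_p)| = p(p−1)²(p+1)`**: the image of `Γ_K` in `Aut(E[p])` is a subgroup of
`Aut(E[p]) ≅ GL₂(𝔽_p)` (Serre 1972 §4.1 "`φ_l : G → Aut(E_l) ≅ GL₂(𝔽_l)`"; `E[p] ≅ 𝔽_p²` by the tree's
`card_torsionPoints_eq_sq_holds`, framed by `exists_addEquiv_mulEquiv_addAut_GL2`).
[cite: Serre1972, §4.1] [cite: Mochizuki2012, IUTchIV Thm 1.10 proof Step (ii) p.24] -/
theorem natCard_range_galoisRepTorsion_dvd :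
    Nat.card (W.galoisRepTorsion (p : ℤ)).range ∣ p * (p - 1) ^ 2 * (p + 1) := by
  letI : Module (ZMod p) (geomTorsion W (p : ℤ)) := AddSubgroup.torsionBy.zmodModule
  have hpF : ((p : ℕ) : AlgebraicClosure K) ≠ 0 := by
    haveI : CharZero (AlgebraicClosure K) :=
      charZero_of_injective_algebraMap (algebraMap K (AlgebraicClosure K)).injective
    exact_mod_cast hp.out.ne_zero
  have hcard : Nat.card (geomTorsion W (p : ℤ)) = p ^ 2 :=
    card_torsionPoints_eq_sq_holds W (AlgebraicClosure K) hpF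
  obtain ⟨-, Φ, -, -, -⟩ := exists_addEquiv_mulEquiv_addAut_GL2 (ℓ := p) (geomTorsion W (p : ℤ)) hcard
  haveI : Finite (GL (Fin 2) (ZMod p)) := inferInstance
  haveI : Finite (Multiplicative (AddAut (geomTorsion W (p : ℤ)))) :=
    Finite.of_equiv _ Φ.toEquiv.symm
  rw [← card_GL_two_zmod p, ← Nat.card_congr Φ.toEquiv]
  exact Subgroup.card_subgroup_dvd_card _

/-- The kernel of `ρ̄_{E,p}` has index `#ρ̄_{E,p}(Γ_K) ∣ p(p−1)²(p+1)` in `Γ_K`.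
[cite: Serre1972, §4.1] -/
theorem index_ker_galoisRepTorsion_dvd :
    (W.galoisRepTorsion (p : ℤ)).ker.index ∣ p * (p - 1) ^ 2 * (p + 1) := by
  rw [Subgroup.index_ker]
  exact W.natCard_range_galoisRepTorsion_dvd p

/-- **`[L:K] ∣ p(p−1)²(p+1)` for every subextension `L ⊆ K̄` of `K` inside the `p`-division field**,
i.e. fixed by every `σ ∈ Γ_K` acting trivially on `E[p]` (`ker ρ̄_{E,p} ≤ Gal(K̄/L)`): `[L:K] =
[Γ_K : Gal(K̄/L)]` (Krull) divides `[Γ_K : ker ρ̄] = #ρ̄(Γ_K)`.  This is the divisibility behind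
"`Gal(K/F) ↪ GL₂(𝔽_l)`" in [IUTchIV] Thm. 1.10 Step (ii) (`K = F(E_F[l])`).
[cite: Mochizuki2012, IUTchIV Thm 1.10 proof Step (ii) p.24] [cite: Serre1972, §4.1] -/
theorem finrank_dvd_of_ker_galoisRepTorsion_le_fixingSubgroup
    (L : IntermediateField K (AlgebraicClosure K))
    (hL : (W.galoisRepTorsion (p : ℤ)).ker ≤ L.fixingSubgroup) :
    Module.finrank K L ∣ p * (p - 1) ^ 2 * (p + 1) := by
  rw [IntermediateField.finrank_eq_fixingSubgroup_index]
  exact (Subgroup.index_dvd_of_le hL).trans (W.index_ker_galoisRepTorsion_dvd p)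

/-- **The `p`-division field `K(E[p]) = K̄^{ker ρ̄_{E,p}}` has degree dividing `p(p−1)²(p+1)`** (indeed
equal to `#ρ̄_{E,p}(Γ_K)`: `finrank_fixedField_of_isOpen` with the open kernel
`isOpen_ker_galoisRepTorsion_holds`). [cite: Serre1972, §4.1] [cite: SilvermanAEC2009, III.§7] -/
theorem finrank_fixedField_ker_galoisRepTorsion_dvd :
    Module.finrank K (IntermediateField.fixedField (W.galoisRepTorsion (p : ℤ)).ker :
      IntermediateField K (AlgebraicClosure K)) ∣ p * (p - 1) ^ 2 * (p + 1) := by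
  have hopen : IsOpen (((W.galoisRepTorsion (p : ℤ)).ker : Subgroup (absoluteGaloisGroup K)) :
      Set (absoluteGaloisGroup K)) :=
    W.isOpen_ker_galoisRepTorsion_holds (n := (p : ℤ)) (by exact_mod_cast hp.out.ne_zero)
  rw [finrank_fixedField_of_isOpen _ hopen]
  exact W.index_ker_galoisRepTorsion_dvd p

/-- **Two torsion levels**: for primes `p, q` and a subextension `L ⊆ K̄` of `K` fixed by
`ker ρ̄_{E,p} ⊓ ker ρ̄_{E,q}` (i.e. `L ⊆ K(E[p], E[q])`): `[L:K] ∣ p(p−1)²(p+1) · q(q−1)²(q+1)` — the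
divisibility behind "`Gal(F/F_tpd) ↪ GL₂(𝔽₃) × GL₂(𝔽₅) × ℤ/2ℤ`" of [IUTchIV] Thm. 1.10 Step (ii) for the
`(3·5)`-torsion part (the index of an intersection with a NORMAL subgroup divides the product of the
indices). [cite: Mochizuki2012, IUTchIV Thm 1.10 proof Step (ii) p.24] [cite: Serre1972, §4.1] -/
theorem finrank_dvd_of_ker_inf_ker_le_fixingSubgroup (q : ℕ) [hq : Fact q.Prime]
    (L : IntermediateField K (AlgebraicClosure K))
    (hL : (W.galoisRepTorsion (p : ℤ)).ker ⊓ (W.galoisRepTorsion (q : ℤ)).ker ≤ L.fixingSubgroup) :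
    Module.finrank K L ∣ (p * (p - 1) ^ 2 * (p + 1)) * (q * (q - 1) ^ 2 * (q + 1)) := by
  set Hp := (W.galoisRepTorsion (p : ℤ)).ker with hHp
  set Hq := (W.galoisRepTorsion (q : ℤ)).ker with hHq
  have hinf : (Hp ⊓ Hq).index ∣ Hp.index * Hq.index := by
    rw [← Subgroup.relIndex_mul_index (inf_le_right : Hp ⊓ Hq ≤ Hq), Subgroup.inf_relIndex_right]
    exact Nat.mul_dvd_mul_right (Subgroup.relIndex_dvd_index_of_normal Hp Hq) Hq.index
  rw [IntermediateField.finrank_eq_fixingSubgroup_index]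
  refine ((Subgroup.index_dvd_of_le hL).trans hinf).trans ?_
  exact Nat.mul_dvd_mul (W.index_ker_galoisRepTorsion_dvd p) (W.index_ker_galoisRepTorsion_dvd q)

end WeierstrassCurve

end
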